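import Mathlib
import HarnessLib
import Summits.HubbardSuperconductivity.HubbardSuperconductivity.Theorems.KLProgrammeKLRegimeEngineTowerWtBlockZeroLevelLawKlEng
import Summits.HubbardSuperconductivity.HubbardSuperconductivity.Theorems.KLProgrammeKLRegimeEngineTowerWtAssemblyKlEng
import Summits.HubbardSuperconductivity.HubbardSuperconductivity.Theorems.KLProgrammeKLRegimeEngineTowerImportWtArrays

/-!
# Route `KLProgramme` — crux K3 ENGINE (stmt-HubbardSuperconductivity-20437 `KLRegimeEngineV17F2`), stub (b) v2, THE WEIGHTED HALF «(b)-WT4»: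
# W11b — «WB4» part 2: STUB (b)'s WEIGHTED CLAUSE AT THE BLOCK-0 LEVELS `1 ≤ j ≤ d` ON THE FLOW FRAME
# (cell gate-hubbard-kl, seat hubbard-kl-k3c3-p2 g17; the weighted twin of p3 g22's `kernelNormsLevels_blockZeroF_klEng`; E1 may rename or supersede)

`KernelNormsWt4 L M (klWtBudget P Qe U j) β U μ (K_n) j` at a block-0 level `1 ≤ j ≤ d`, `j ≤ n`, by the degree split of W8: odd degrees vanish
(`kernelNormsWt4_of_even`), `m = 0` has no pin, `m = 4` is the import CELL (k3c2-p3's `klWtPinnedSum_four_le_of_wplain_flow_all`: the `klScaleWt_j`-weighted PLAIN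
four-leg pinned lines of `𝒱_j[K_n]` bounded by `S₄ j` [E1] and the threshold `klThinCountC·sectorCount j·CW₄⁴·S₄ j ≤ klWtBudget P Qe U j 4` [numerics]; the
thin-count doors folded into `(c₃′, U₀′)`), degrees above `card (HubbardFieldIdx L M) ≤ 2D+1` carry nothing (`klWtPinnedSum_eq_zero_of_card_lt`), and every
`6 ≤ 2p ≤ 2D`... indeed EVERY `p ≥ 3` is W11a's unit law `levelLawWt_blockZero_klEng` at `λ_j = B·ε_j` turned into the registered budget by
`readoutLev_le_levelsRHS` (track `0`) and `klWtBudget_two_mul_of_two_le` under the threshold `Q_tot·ε_x²·B·max 1 (A_tot(j)/ε_x) ≤ Qe.CE`: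
* **`kernelNormsWt4_blockZero_klEng (d R c″)`** — head `∃ C_inc D_inc ≥ 1, ∃ Cκ CJ Cα > 0, ∃ CW₄ > 0`, `R.WF2 → ∃ c₃′ U₀′`; rows = W11a's at every block-0 rate
  `1 ≤ j ≤ d`, `j ≤ n` (datum unit law, one ∧-bundle of Chernoff/import/smallness/guard rows at `λ_j`), `A_tot : ℕ → ℝ` equational, the CE row, the cap
  `card (HubbardFieldIdx) ≤ 2D+1`, the four-leg plain lines and thresholds ⊢ `∀ j, 1 ≤ j → j ≤ d → j ≤ n → KernelNormsWt4 L M (klWtBudget P Qe U j) β U μ (K_n) j`.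
This is the `hlow′` row of W10 `kernelNormsWt4_all_klEng_structural` (p703207); W12 plugs it in. Compositions of landed theorems; nothing asserts (b), WT4's rows, (ℓ),
any stub, K3 or superconductivity.
References: BGM 2006 §2.7 (2.71a), §2.8 (2.76)–(2.84), (2.93)–(2.98), Lemma 2.5, §3 (3.2)–(3.8) [cite: BenfattoGiulianiMastropietro2006].
-/

noncomputable section

namespace Summit.HubbardSuperconductivity.HubbardSuperconductivity.Theorems.EngineV8

set_option linter.dupNamespace false -- summit = problem name (single-conjunct summit), D-0017

open Classical
open Real Finset Literature.MathematicalPhysics.QuantumLattice Literature.Probability.LatticeModels GrassmannAlgebra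
open Literature.MathematicalPhysics.QuantumLattice.FermiRG
open Summit.HubbardSuperconductivity.HubbardSuperconductivity.Theorems.KLProgrammeLegKernels
open Summit.HubbardSuperconductivity.HubbardSuperconductivity.Theorems.KLRegimeSplit
open Summit.HubbardSuperconductivity.HubbardSuperconductivity.Theorems.KLRegimeWick
open Summit.HubbardSuperconductivity.HubbardSuperconductivity.Theorems.TwoPointAssembly
open Summit.HubbardSuperconductivity.HubbardSuperconductivity.Theorems.TorusFourierL2
open Summit.HubbardSuperconductivity.HubbardSuperconductivity.Theorems.DispersionFlow
open Literature.Probability.LatticeModels.BattleFederbush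

/-- **STUB (b)'s WEIGHTED CLAUSE AT THE BLOCK-0 LEVELS `1 ≤ j ≤ d`** («WB4» part 2; see the module docstring for the degree split and the row list):
conclusion `∀ j, 1 ≤ j → j ≤ d → j ≤ n → KernelNormsWt4 L M (klWtBudget P Qe U j) β U μ (klFlowFrameU L M β U μ n) j`.
[cite: BenfattoGiulianiMastropietro2006, §2.7 (2.71a), §2.8 (2.82)-(2.84), (2.93)-(2.98), Lemma 2.5 (2.98)] -/
theorem kernelNormsWt4_blockZero_klEng (d : ℕ) (R : RenConsts) (c'' : ℝ) (hc'' : 0 < c'') :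
    ∃ Cinc Dinc : ℝ, 1 ≤ Cinc ∧ 1 ≤ Dinc ∧ ∃ Cκ CJ Cα : ℝ, 0 < Cκ ∧ 0 < CJ ∧ 0 < Cα ∧ ∃ CW₄ : ℝ, 0 < CW₄ ∧
      (R.WF2 → ∃ c₃' : ℝ, 0 < c₃' ∧ ∃ U₀' : ℝ, 0 < U₀' ∧
      ∀ (G : GeoConsts) (P : SplitConsts) (Q : EngConsts) (c : ℝ), P.WF → 0 < c → c ≤ klEngC₃6 P R → c ≤ c₃' →
      ∀ μ ∈ klWindowC, ∀ U : ℝ, 0 < U → U ≤ klEngU₀9 P R c → U ≤ U₀' → c'' * U ≤ 1 →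
      ∀ β : ℝ, klBetaMin ≤ β → β ≤ Real.exp (c / U ^ 2) →
      ∀ (L M : ℕ) [NeZero L] [NeZero M], klEngL₃ β U ≤ L → klEngM₃ β U L ≤ M →
      ∀ n : ℕ, 1 ≤ n → n ≤ nScales β + 1 → IsKLRegime U c (-(n : ℤ)) → HistP klPredsV17F2 L M G P Q R β U μ 0 n →
        (∀ m, 1 ≤ m → m < n → FlowPieceOscAt L M c'' β U μ m) →
      hubbardEffPartitionFnCT L M β U μ 0 (klFlowFrameU L M β U μ n) (klScale klE0 1) ≠ 0 →
      -- the caps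
      ∀ D : ℕ, Fintype.card (SpaceTimeIdx L M × SectorLeg (sectorCount 0)) / 2 ≤ D → Fintype.card (HubbardFieldIdx L M) ≤ 2 * D + 1 →
      -- the coupling amplitude and the level-0 datum's amplitudes
      ∀ (B Ab Qb : ℝ), 1 ≤ B → 0 ≤ Ab → 0 ≤ Qb →
      -- the decay name `ᾱ := Cα·M/β`, the pins and the kit names (equational binders)
      ∀ (αb κb crb ccb W Z σ τ ψ Φ : ℝ), αb = Cα * ((M : ℝ) / β) → κb = Real.sqrt (2 * Cκ * klE0) → crb = 81 * CJ * M / β → ccb = 162 * CJ * M / β →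
        W = 32 * crb / ccb → Z = imagTimeWeight β M ^ 2 * ccb ^ 2 / 8 → σ = κb ^ 2 / ccb ^ 2 → τ = 4 * exp 4 * κb ^ 2 / ccb ^ 2 →
        ψ = ccb ^ 2 / κb ^ 2 → Φ = exp 1 * αb * ccb / (κb ^ 2 * crb) →
      ∀ (A' Q' ι₁ ι₂ ι₃ : ℝ), 0 ≤ A' → 0 < Q' →
      -- the level-`0` weighted datum at every block-0 rate `1 ≤ j ≤ d`, `j ≤ n`: its unit law at `(F_0, rate j)`, `p ≥ 3` [kit currency]
      (∀ j, 1 ≤ j → j ≤ d → j ≤ n → ∀ p : ℕ, 3 ≤ p →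
        klTowerMeasWtAt L M β U μ (klFlowFrameU L M β U μ n) 1 1 j (2 * p) / klLevUnitF β M 0 p 0 ≤ Ab * (B * epsCoupling P U j) ^ (p - 1) * Qb ^ p) →
      -- its Chernoff / import rows at `λ_j`, the five smallness rows and the block-`0` kit guard, rate by rate [numerics / kit currency]
      (∀ j, 1 ≤ j → j ≤ d → j ≤ n →
        (∀ m, 4 ≤ m → m ≤ D → W * Z ^ m * (klTowerMeasWtAt L M β U μ (klFlowFrameU L M β U μ n) 1 1 j (2 * m) / klLevUnitF β M 0 m 0) ≤
          A' * (B * epsCoupling P U j) ^ (m - 1) * Q' ^ m) ∧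
        W * Z ^ 3 * (klTowerMeasWtAt L M β U μ (klFlowFrameU L M β U μ n) 1 1 j (2 * 3) / klLevUnitF β M 0 3 0) ≤ ι₃ * (B * epsCoupling P U j) ^ 2 ∧
        W * Z ^ 1 * (klTowerMeasWtAt L M β U μ (klFlowFrameU L M β U μ n) 1 1 j (2 * 1) / klLevUnitF β M 0 1 0) ≤ ι₁ * (B * epsCoupling P U j) ∧
        W * Z ^ 2 * (klTowerMeasWtAt L M β U μ (klFlowFrameU L M β U μ n) 1 1 j (2 * 2) / klLevUnitF β M 0 2 0) ≤ ι₂ * (B * epsCoupling P U j) ∧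
        4 * σ * (B * epsCoupling P U j) * Q' < 1 ∧ 2 * (B * epsCoupling P U j) * τ * Q' ≤ 1 ∧ exp 1 * τ * (B * epsCoupling P U j) * Q' < 1 ∧
        Φ * (τ * (ι₁ * (B * epsCoupling P U j) + ι₂ / (2 * Q') + ι₃ / (4 * Q' ^ 2) + A' * Q' / 4)) < 1 ∧
        Φ * (exp 1 * τ * (ι₁ * (B * epsCoupling P U j)) + (exp 1 * τ) ^ 2 * (ι₂ * (B * epsCoupling P U j)) +
          (exp 1 * τ) ^ 3 * (ι₃ * (B * epsCoupling P U j) ^ 2) +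
          A' * (exp 1 * τ * Q') * ((exp 1 * τ * (B * epsCoupling P U j) * Q') ^ 3 / (1 - exp 1 * τ * (B * epsCoupling P U j) * Q'))) < 1 ∧
        Φ * towerV D τ (fun m => W * Z ^ m *
          (klTowerMeasWtAt L M β U μ (klFlowFrameU L M β U μ n) 1 1 j (2 * m) / klLevUnitF β M 0 m 0)) < 1) →
      -- the read-out constants (equational binders, `A_tot` rate by rate) and the budget package's `CE` row at the block-0 levels
      ∀ (Aro Qro Qtot : ℝ) (Atot : ℕ → ℝ), Aro = Cinc * Ab → Qro = Dinc * Qb → Qtot = Dinc * max 1 (max Qro (max (4 * Q') (2 * τ * ψ * Q'))) →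
        (∀ j, Atot j = Aro + Cinc * (A' * (4 * σ * (B * epsCoupling P U j) * Q' / (1 - 4 * σ * (B * epsCoupling P U j) * Q')) +
          exp 1 * (τ * (ι₁ * (B * epsCoupling P U j) + ι₂ / (2 * Q') + ι₃ / (4 * Q' ^ 2) + A' * Q' / 4)) *
            (Φ * (τ * (ι₁ * (B * epsCoupling P U j) + ι₂ / (2 * Q') + ι₃ / (4 * Q' ^ 2) + A' * Q' / 4)) /
              (1 - Φ * (τ * (ι₁ * (B * epsCoupling P U j) + ι₂ / (2 * Q') + ι₃ / (4 * Q' ^ 2) + A' * Q' / 4)))) / (2 * τ * Q'))) →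
      ∀ Qe : EngConsts, (∀ j, 1 ≤ j → j ≤ d → j ≤ n → Qtot * imagTimeWeight β M ^ 2 * B * max 1 (Atot j / imagTimeWeight β M) ≤ Qe.CE) →
      -- the four-leg CELL at the block-0 levels: weighted PLAIN four-leg pinned lines of `𝒱_j[K_n]` [E1] and their thresholds [numerics]
      ∀ S₄ : ℕ → ℝ, (∀ j, 0 ≤ S₄ j) →
      (∀ j, 1 ≤ j → j ≤ d → j ≤ n → ∀ (q : Fin 4) (τ' : Fin 4 → SectorLeg 1) (y' : SpaceTimeIdx L M),
        imagTimeWeight β M ^ 3 * ∑ x' ∈ univ.filter (fun x' : Fin 4 → SpaceTimeIdx L M => x' q = y'),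
          klScaleWt L M β j ((univ.image x').image (fun x : SpaceTimeIdx L M => (((((2 * (x.1 : ℕ) : ℕ)) : ZMod (2 * (2 * M)))), x.2))) *
            ‖sectorisedKernel L M β (trivialMultiplier L M) (klEffectiveAction L M β U μ (klFlowFrameU L M β U μ n) klE0 j) 4 τ' x'‖ ≤ S₄ j) →
      (∀ j, 1 ≤ j → j ≤ d → j ≤ n → klThinCountC * sectorCount j * (CW₄ ^ 4 * S₄ j) ≤ klWtBudget P Qe U j 4) →
      ∀ j : ℕ, 1 ≤ j → j ≤ d → j ≤ n → KernelNormsWt4 L M (klWtBudget P Qe U j) β U μ (klFlowFrameU L M β U μ n) j) := by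
  obtain ⟨Cinc, Dinc, hCinc, hDinc, Cκ, CJ, Cα, hCκ, hCJ, hCα, hlaw⟩ := levelLawWt_blockZero_klEng d R c'' hc''
  obtain ⟨CW₄, hCW₄, hc4⟩ := klWtPinnedSum_four_le_of_wplain_flow_all R c'' hc''.le
  refine ⟨Cinc, Dinc, hCinc, hDinc, Cκ, CJ, Cα, hCκ, hCJ, hCα, CW₄, hCW₄, fun hR2 => ?_⟩
  obtain ⟨c₃a, hc₃a, U₀a, hU₀a, hlaw'⟩ := hlaw hR2
  refine ⟨min c₃a (klThinCountC₃ R), lt_min hc₃a (klThinCountC₃_pos R), min U₀a (klThinCountU₀ R), lt_min hU₀a (klThinCountU₀_pos R), ?_⟩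
  intro G P Q c hP hc hc6 hc₃' μ hμ U hU hU9 hU₀' hcU β hβmin hβc L M _ _ hL3 hM3 n hn1 hnN hkl hhist hosc hZ1 D hD0 hcard B Ab Qb hB hAb hQb
    αb κb crb ccb W Z σ τ ψ Φ hαb hκb hcrb hccb hW hZ hσ hτ hψ hΦ A' Q' ι₁ ι₂ ι₃ hA'0 hQ'0 hlawb hblk Aro Qro Qtot Atot hAro hQro hQtot hAtot
    Qe hCE S₄ hS₄0 hL4 hT4 j hj1 hjd hjn
  have hc₃a' : c ≤ c₃a := hc₃'.trans (min_le_left _ _)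
  have hcT : c ≤ klThinCountC₃ R := hc₃'.trans (min_le_right _ _)
  have hU₀a' : U ≤ U₀a := hU₀'.trans (min_le_left _ _)
  have hUT : U ≤ klThinCountU₀ R := hU₀'.trans (min_le_right _ _)
  have hU3g : U ≤ min (klEngU₀3 P R c) (1 / (R.Gfr 3 + 1)) :=
    le_min (hU9.trans (klEngU₀9_le_klEngU₀3 P R c)) (hU9.trans (klEngU₀9_le_inv_gfr_add_one P hR2.wf c (by norm_num)))
  have hβ : 0 < β := KLRegimeSplit.pos_of_klBetaMin_le hβmin
  have hK1 : 1 ≤ P.Klam := hP.1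
  have hKl : 0 ≤ P.Klam := le_trans zero_le_one hK1
  have hfr : FrameOK R U (nScales β) μ (klFlowFrameU L M β U μ n) := frameOK_klFlowFrameU_of_histP_le hR2 hn1 le_rfl hnN hhist
  set K : TrigPolyC4v := klFlowFrameU L M β U μ n with hKdef
  have hεpos : 0 < epsCoupling P U j := by
    unfold epsCoupling; have : 0 < P.Klam := by linarith
    positivity
  have hlam : 0 < B * epsCoupling P U j := by positivity
  -- `0 ≤ Qe.CE` from the CE row at this level
  have hεx : 0 < imagTimeWeight β M := imagTimeWeight_pos_of_pos (M := M) hβ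
  have hτ0 : 0 < τ := by
    have he0 : (0 : ℝ) < klE0 := by norm_num [klE0]
    have hM0 : (0 : ℝ) < M := Nat.cast_pos.2 (Nat.pos_of_ne_zero (NeZero.ne M))
    have hκb0 : 0 < κb := by rw [hκb]; exact Real.sqrt_pos.2 (by positivity)
    have hccb0 : 0 < ccb := by rw [hccb]; positivity
    rw [hτ]; positivity
  have hQtot0 : 0 ≤ Qtot := by rw [hQtot]; exact mul_nonneg (zero_le_one.trans hDinc) (zero_le_one.trans (le_max_left _ _))
  have hQtot1 : Dinc * 1 ≤ Qtot := by rw [hQtot]; exact mul_le_mul_of_nonneg_left (le_max_left _ _) (zero_le_one.trans hDinc)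
  have hCE0 : 0 ≤ Qe.CE := by
    refine le_trans ?_ (hCE j hj1 hjd hjn)
    have h1 : 1 ≤ max 1 (Atot j / imagTimeWeight β M) := le_max_left _ _
    have hB0 : 0 ≤ B := zero_le_one.trans hB
    positivity
  -- the unit law of `𝒱_j[K_n]` at `(F_j, rate j)`, every `p ≥ 3` (W11a)
  obtain ⟨hprof, hprof3, himp₁, himp₂, hx₁, hx₂, hx₃, hy, hθ, hguard⟩ := hblk j hj1 hjd hjn
  have hL : ∀ p : ℕ, 3 ≤ p → ∀ (q : Fin (2 * p)) (w : SpaceTimeIdx L M × SectorLeg (sectorCount j)),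
      klWtPinnedSum L M β U μ K j (2 * p) q w / klLevUnitF β M 0 p j ≤ Atot j * (B * epsCoupling P U j) ^ (p - 1) * Qtot ^ p :=
    fun p hp q w => hlaw' G P Q c hP hc hc6 hc₃a' μ hμ U hU hU9 hU₀a' hcU β hβmin hβc L M hL3 hM3 n hn1 hnN hkl hhist hfr hosc hZ1 j D hj1 hjd hjn hD0
      (B * epsCoupling P U j) Ab Qb hlam hAb hQb αb κb crb ccb W Z σ τ ψ Φ hαb hκb hcrb hccb hW hZ hσ hτ hψ hΦ A' Q' ι₁ ι₂ ι₃ hA'0 hQ'0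
      (hlawb j hj1 hjd hjn) hprof hprof3 himp₁ himp₂ hx₁ hx₂ hx₃ hy hθ hguard Aro Qro Qtot (Atot j) hAro hQro hQtot (hAtot j) p hp q w
  -- `0 ≤ A_tot j` from the law in degree `6` (the left side is nonnegative, `λ > 0`, `Q_tot > 0`)
  have hAtot0 : 0 ≤ Atot j := by
    have hQpos : 0 < Qtot := lt_of_lt_of_le (by linarith [hDinc]) hQtot1
    by_cases hq : Nonempty (Fin (2 * 3)) ∧ Nonempty (SpaceTimeIdx L M × SectorLeg (sectorCount j))
    · obtain ⟨⟨q⟩, ⟨w⟩⟩ := hq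
      have h1 := hL 3 le_rfl q w
      have h0 : 0 ≤ klWtPinnedSum L M β U μ K j (2 * 3) q w / klLevUnitF β M 0 3 j :=
        div_nonneg (klWtPinnedSum_nonneg L M hβ.le U μ K j _ q w) (klLevUnitF_pos hβ 0 3 j).le
      have h2 : 0 ≤ Atot j * ((B * epsCoupling P U j) ^ (3 - 1) * Qtot ^ 3) := by rw [← mul_assoc]; exact h0.trans h1
      rw [mul_comm] at h2
      exact nonneg_of_mul_nonneg_right h2 (by positivity)
    · -- no pin at all: read `A_tot j ≥ A_ro ≥ 0` off its formula
      rw [hAtot j, hAro]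
      have hσ0 : 0 ≤ σ := by rw [hσ]; positivity
      have hψ0 : 0 ≤ ψ := by rw [hψ]; positivity
      have hΦ0 : 0 ≤ Φ := by
        have hM0 : (0 : ℝ) < M := Nat.cast_pos.2 (Nat.pos_of_ne_zero (NeZero.ne M))
        have hαb0 : 0 ≤ αb := by rw [hαb]; positivity
        have hcrb0 : 0 ≤ crb := by rw [hcrb]; positivity
        have hccb0 : 0 ≤ ccb := by rw [hccb]; positivity
        rw [hΦ]; positivity
      have hW0 : 0 ≤ W := by
        have hM0 : (0 : ℝ) < M := Nat.cast_pos.2 (Nat.pos_of_ne_zero (NeZero.ne M))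
        have hcrb0 : 0 ≤ crb := by rw [hcrb]; positivity
        have hccb0 : 0 ≤ ccb := by rw [hccb]; positivity
        rw [hW]; positivity
      have hZ0 : 0 ≤ Z := by rw [hZ]; positivity
      have hμ0 : ∀ m, 0 ≤ W * Z ^ m * (klTowerMeasWtAt L M β U μ K 1 1 j (2 * m) / klLevUnitF β M 0 m 0) := fun m =>
        mul_nonneg (by positivity) (div_nonneg (klTowerMeasWtAt_nonneg hβ.le U μ K 1 1 j _) (klLevUnitF_pos hβ 0 m 0).le)
      have hι₁0 : 0 ≤ ι₁ := by
        have h1 : 0 ≤ ι₁ * (B * epsCoupling P U j) := (hμ0 1).trans himp₁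
        rw [mul_comm] at h1; exact nonneg_of_mul_nonneg_right h1 hlam
      have hι₂0 : 0 ≤ ι₂ := by
        have h1 : 0 ≤ ι₂ * (B * epsCoupling P U j) := (hμ0 2).trans himp₂
        rw [mul_comm] at h1; exact nonneg_of_mul_nonneg_right h1 hlam
      have hι₃0 : 0 ≤ ι₃ := by
        have h1 : 0 ≤ ι₃ * (B * epsCoupling P U j) ^ 2 := (hμ0 3).trans hprof3
        rw [mul_comm] at h1; exact nonneg_of_mul_nonneg_right h1 (by positivity)
      have hx10 : 0 ≤ 4 * σ * (B * epsCoupling P U j) * Q' / (1 - 4 * σ * (B * epsCoupling P U j) * Q') :=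
        div_nonneg (by positivity) (sub_nonneg.2 hx₁.le)
      have hY0 : 0 ≤ τ * (ι₁ * (B * epsCoupling P U j) + ι₂ / (2 * Q') + ι₃ / (4 * Q' ^ 2) + A' * Q' / 4) := by positivity
      have hYy : 0 ≤ Φ * (τ * (ι₁ * (B * epsCoupling P U j) + ι₂ / (2 * Q') + ι₃ / (4 * Q' ^ 2) + A' * Q' / 4)) /
          (1 - Φ * (τ * (ι₁ * (B * epsCoupling P U j) + ι₂ / (2 * Q') + ι₃ / (4 * Q' ^ 2) + A' * Q' / 4))) :=
        div_nonneg (by positivity) (sub_nonneg.2 hy.le)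
      have hC0 : 0 ≤ Cinc := zero_le_one.trans hCinc
      positivity
  -- the four-leg cell
  have hcell4 : ∀ (q : Fin 4) (w : SpaceTimeIdx L M × SectorLeg (sectorCount j)), klWtPinnedSum L M β U μ K j 4 q w ≤ klWtBudget P Qe U j 4 :=
    fun q w => (hc4 G P Q c hR2 hc hc6 hcT μ hμ U hU hU3g hUT hcU β hβmin hβc L M hL3 hM3 n hn1 hnN hkl hhist hosc j hj1 hjn q w (S₄ j) (hS₄0 j)
      (fun τ' y' => hL4 j hj1 hjd hjn q τ' y')).trans (hT4 j hj1 hjd hjn)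
  -- the degree split
  refine kernelNormsWt4_of_even hβ.ne' (fun m _ => klWtBudget_nonneg hCE0 hKl U j m) fun m hm hm2 q w => ?_
  obtain ⟨p, rfl⟩ : ∃ p, m = 2 * p := by obtain ⟨r, hr⟩ := hm; exact ⟨r, by omega⟩
  rcases Nat.lt_or_ge p 3 with hp3 | hp3
  · interval_cases p
    · exact q.elim0
    · exact absurd rfl hm2
    · exact hcell4 q w
  · rcases Nat.lt_or_ge D p with hDp | hpD
    · rw [klWtPinnedSum_eq_zero_of_card_lt β U μ K j (by omega) q w]
      exact klWtBudget_nonneg hCE0 hKl U j _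
    · have hfinal := readoutLev_le_levelsRHS (M := M) (P := P) hβ hKl U hAtot0 hQtot0 hB (hCE j hj1 hjd hjn) 0 (by omega : 1 ≤ p) j
        (X := klWtPinnedSum L M β U μ K j (2 * p) q w) (hL p hp3 q w)
      rw [show levelGainExp (((0 : Fin 5) : ℕ) + 1) = 0 from rfl, pow_zero, mul_one] at hfinal
      rw [klWtBudget_two_mul_of_two_le P Qe U j (by omega : 2 ≤ p)]
      exact hfinal

end Summit.HubbardSuperconductivity.HubbardSuperconductivity.Theorems.EngineV8

end
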